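import Summits.AtomisticToContinuum.Crystallization.Theorems.HolmgrenBoyleLindGroundStatesChargeFLCEquilibriumOfMinimisingLawsChargeFLC
import Summits.AtomisticToContinuum.Crystallization.Theorems.HolmgrenBoyleLindGroundStatesChargeFLCEquilibriumStub1OfPeriodicSupport

/-!
# Crux `HolmgrenBoyleLind.GroundStatesChargeFLCEquilibrium` (stmt-AtomisticToContinuum-6076)
# from `PeriodicSupport` (stmt-AtomisticToContinuum-12747)

`groundStatesChargeFLCEquilibrium_of_periodicSupport : PeriodicSupport → GroundStatesChargeFLCEquilibrium`
— the Palm-side crux of route `BenjaminiSchrammPeriodicSupport` (minimising point-stationary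
hard-core laws charge ONE periodic configuration) implies this route's crux LIM, by composing the
landed `stub_minimisingLawsChargeFLC_of_periodicSupport` (12747 ⇒ the line's content stub) with the
landed `groundStatesChargeFLCEquilibrium_of_minimisingLawsChargeFLC` (content stub ⇒ crux).
CONDITIONAL on the open item 12747; nothing here closes an item. [folklore]
-/

namespace Summit.AtomisticToContinuum.Crystallization.Theorems.HolmgrenBoyleLindGroundStatesChargeFLCEquilibrium

/-- **`PeriodicSupport` (item 12747) implies the crux `GroundStatesChargeFLCEquilibrium`**
(conditional reduction; composition of two landed theorems). [folklore] -/
theorem groundStatesChargeFLCEquilibrium_of_periodicSupport :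
    Summit.AtomisticToContinuum.Crystallization.Theses.BenjaminiSchrammPeriodicSupport.PeriodicSupport →
    Summit.AtomisticToContinuum.Crystallization.Theses.HolmgrenBoyleLind.GroundStatesChargeFLCEquilibrium :=
  fun hPS => groundStatesChargeFLCEquilibrium_of_minimisingLawsChargeFLC
    (stub_minimisingLawsChargeFLC_of_periodicSupport hPS)

end Summit.AtomisticToContinuum.Crystallization.Theorems.HolmgrenBoyleLindGroundStatesChargeFLCEquilibrium
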